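import Summits.CriticalPhenomena.PercolationContinuityZ3.Theorems.PercNearOneGluingNoHeavyLowerTailSahiOneStepAndLiteral
import HarnessLib

/-!
# One-step scheme: the OR-LITERAL STEP for an ARBITRARY first event

Prover prim-ineq-prove-3 gen 26 (`--supports stmt-CriticalPhenomena-4575`; memo
`run/shared/lean/prim/prim-ineq-prove-3/FINDING-G26C-NORMAL-FORM.md` §6).  No definitions, no sorries.

Companion of `…SahiOneStepAndLiteral`.  For `e ∉ F`, an ARBITRARY increasing `A` (sections `A¹ ⊇ A⁰` at `e`) and an increasing `B` not
depending on `e`, the step form `M₂` (gen 19, `osN_ind_ind_pivot_eq`) of the pair `(A, {e ∈ ω} ∪ B)` at the slot `{N_{insert e F} ≥ t+1}`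
satisfies the EXACT identity (`S = {N_F = t}`, `σ = μ S`, `L¹ = {N_F < t}`, `L⁰ = {N_F < t+1}`, `H⁰ = {N_F ≥ t+1}`, `ℓ^z = μ L^z`)
`σℓ⁰·M₂ = σℓ¹·n_{H⁰}(A¹,B) + U_A·U_B + ℓ⁰ μ(Bᶜ ∩ S)·U_A + σℓ⁰ℓ¹·μ((A¹∖A⁰) ∩ Bᶜ ∩ H⁰)`,
`U_X = ℓ¹μ(X ∩ S) − σμ(X ∩ L¹) ≥ 0` (a layer carries more of an increasing event than the ball below it, `real_inter_ball_mul_layer_le'`).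
Hence (`osN_threshold_orLiteral_step`) `(2′)` for `(A, x_e ∨ B)` follows from `(2′)` for `(A¹, B)` and `(A⁰, B)` at the slot `{N_F ≥ t+1}`.
With the AND-literal step and gen 20's block thresholds: the class of events satisfying `(2′)` against EVERY increasing partner is closed under
`x_e ∧ ·` and `x_e ∨ ·` (`osN_orLiteral_universal`), so it contains every monotone function of at most three coordinates — e.g.
`x_a ∨ x_b x_c` (`sahiE3_orAndPair_nonneg`): **Kahn C5 / Sahi `C₃` for a threshold first slot holds whenever one of the other two events
depends on at most three coordinates, for every product measure.**
-/

noncomputable section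

namespace Summit.CriticalPhenomena.PercolationContinuityZ3.Theorems

namespace SahiOneStep

open MeasureTheory Finset
open Literature.Probability.Percolation (DeterminedBy determinedBy_iff determinedBy_univ)
open Literature.Probability.LatticeModels (prodBernoulli sahiE3)
open Literature.Probability.Percolation.DecisionTree (ind)
open scoped Classical

variable {ι : Type*} [Fintype ι]

/-! ## A layer carries more of an increasing event than the ball below it -/

/-- For an increasing `U`: `μ(U ∩ {N_F < t})·μ{N_F = t} ≤ μ(U ∩ {N_F = t})·μ{N_F < t}`, i.e. `μ(U ∣ N_F < t) ≤ μ(U ∣ N_F = t)` — from layer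
monotonicity (unlike `real_inter_ball_mul_layer_le`, `U` need not be determined by `F`). [folklore] -/
theorem real_inter_ball_mul_layer_le' (p : ι → unitInterval) (F : Finset ι) {U : Set (Set ι)} (hU : IsUpperSet U) (t : ℕ) :
    (prodBernoulli p).real (U ∩ {ω : Set ι | (F.filter (· ∈ ω)).card < t}) *
        (prodBernoulli p).real {ω : Set ι | (F.filter (· ∈ ω)).card = t} ≤
      (prodBernoulli p).real (U ∩ {ω : Set ι | (F.filter (· ∈ ω)).card = t}) *
        (prodBernoulli p).real {ω : Set ι | (F.filter (· ∈ ω)).card < t} := by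
  set x : ℕ → ℝ := fun j => (prodBernoulli p).real (U ∩ {ω : Set ι | (F.filter (· ∈ ω)).card = j}) with hx
  set y : ℕ → ℝ := fun j => (prodBernoulli p).real {ω : Set ι | (F.filter (· ∈ ω)).card = j} with hy
  have hmono : ∀ j, j ≤ t → x j * y t ≤ x t * y j := by
    intro j hjt
    have h := real_inter_inter_layer_mul_le p F hU (determinedBy_univ ((↑F : Set ι)ᶜ)) hjt
    rw [Set.inter_univ] at h
    simp only [hx, hy]; exact h
  rw [real_inter_ball_eq_sum p F U t, real_ball_eq_sum p F t]
  change (∑ j ∈ range t, x j) * y t ≤ x t * ∑ j ∈ range t, y j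
  rw [Finset.sum_mul, Finset.mul_sum]
  exact Finset.sum_le_sum fun j hj => hmono j (Finset.mem_range.1 hj).le

/-! ## The OR-literal step -/

/-- **THE OR-LITERAL STEP for an arbitrary first event.**  Let `e ∉ F`, `A` increasing (arbitrary), `B` increasing and determined by a
coordinate set avoiding `e`.  If `(2′)` holds for the pairs `(A¹, B)` and `(A⁰, B)` at the slot `{N_F ≥ t+1}`, then it holds for
`(A, {e ∈ ω} ∪ B)` at the slot `{N_{insert e F} ≥ t+1}`. [this work] -/
theorem osN_threshold_orLiteral_step (p : ι → unitInterval) {F : Finset ι} {e : ι} (he : e ∉ F) (t : ℕ)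
    {A B : Set (Set ι)} (hA : IsUpperSet A) (hB : IsUpperSet B) {SB : Finset ι} (hBS : DeterminedBy B (↑SB : Set ι)) (heB : e ∉ SB)
    (hsec1 : 0 ≤ osN p {ω : Set ι | t + 1 ≤ (F.filter (· ∈ ω)).card} (ind {ω : Set ι | insert e ω ∈ A}) (ind B))
    (hsec0 : 0 ≤ osN p {ω : Set ι | t + 1 ≤ (F.filter (· ∈ ω)).card} (ind {ω : Set ι | ω \ {e} ∈ A}) (ind B)) :
    0 ≤ osN p {ω : Set ι | t + 1 ≤ ((insert e F).filter (· ∈ ω)).card} (ind A) (ind ({ω : Set ι | e ∈ ω} ∪ B)) := by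
  set μ := prodBernoulli p with hμ
  set H1 : Set (Set ι) := {ω : Set ι | t ≤ (F.filter (· ∈ ω)).card} with hH1
  set H0 : Set (Set ι) := {ω : Set ι | t + 1 ≤ (F.filter (· ∈ ω)).card} with hH0
  set L1 : Set (Set ι) := {ω : Set ι | (F.filter (· ∈ ω)).card < t} with hL1
  set L0 : Set (Set ι) := {ω : Set ι | (F.filter (· ∈ ω)).card < t + 1} with hL0
  set S : Set (Set ι) := {ω : Set ι | (F.filter (· ∈ ω)).card = t} with hS
  set A1 : Set (Set ι) := {ω : Set ι | insert e ω ∈ A} with hA1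
  set A0 : Set (Set ι) := {ω : Set ι | ω \ {e} ∈ A} with hA0
  have sH1 : {ω : Set ι | insert e ω ∈ {ω : Set ι | t + 1 ≤ ((insert e F).filter (· ∈ ω)).card}} = H1 := section_insert_threshold he t
  have sH0 : {ω : Set ι | ω \ {e} ∈ {ω : Set ι | t + 1 ≤ ((insert e F).filter (· ∈ ω)).card}} = H0 := section_sdiff_threshold he t
  have sB1 : {ω : Set ι | insert e ω ∈ ({ω : Set ι | e ∈ ω} ∪ B)} = Set.univ := section_insert_or B e
  have sB0 : {ω : Set ι | ω \ {e} ∈ ({ω : Set ι | e ∈ ω} ∪ B)} = B := section_sdiff_or hBS heB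
  have hA1u : IsUpperSet A1 := isUpperSet_section_insert hA e
  have hA01 : A0 ⊆ A1 := section_sdiff_subset_section_insert hA e
  have hH01 : H0 ⊆ H1 := fun ω hω => by simp only [hH0, hH1, Set.mem_setOf_eq] at hω ⊢; omega
  refine osN_ind_ind_nonneg_of_step p {ω : Set ι | t + 1 ≤ ((insert e F).filter (· ∈ ω)).card} A ({ω : Set ι | e ∈ ω} ∪ B) e
    ?_ ?_ ?_ ?_ ?_ ?_
  · rw [sH1, sB1, osN_ind_ind_univ_snd]
  · rw [sH0, sB0]; exact hsec0
  rotate_left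
  · rw [sH1, sH0]; exact measureReal_mono hH01
  · exact measureReal_mono hA01
  · rw [sB1, sB0]; exact measureReal_mono (Set.subset_univ _)
  rw [sH1, sH0, sB1, sB0]
  simp only [Set.inter_univ, probReal_univ]
  -- piece measures
  set l1 : ℝ := μ.real L1 with hl1
  set σ : ℝ := μ.real S with hσ
  set xL : ℝ := μ.real (A1 ∩ L1) with hxL
  set xS : ℝ := μ.real (A1 ∩ S) with hxS
  set xH : ℝ := μ.real (H0 ∩ A1) with hxH
  set yL : ℝ := μ.real (B ∩ L1) with hyL
  set yS : ℝ := μ.real (B ∩ S) with hyS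
  set yH : ℝ := μ.real (H0 ∩ B) with hyH
  set cH : ℝ := μ.real (H0 ∩ A1 ∩ B) with hcH
  set a0H : ℝ := μ.real (H0 ∩ A0) with ha0H
  set a0Lo : ℝ := μ.real (A0 ∩ L0) with ha0Lo
  set w0 : ℝ := μ.real (H0 ∩ A0 ∩ B) with hw0
  -- set identities used for the splits
  have cL0 : ∀ X : Set (Set ι), X \ H0 = X ∩ L0 := fun X => by
    ext ω; simp only [hH0, hL0, Set.mem_sdiff, Set.mem_inter_iff, Set.mem_setOf_eq, not_le]
  have cL1 : ∀ X : Set (Set ι), X \ H1 = X ∩ L1 := fun X => by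
    ext ω; simp only [hH1, hL1, Set.mem_sdiff, Set.mem_inter_iff, Set.mem_setOf_eq, not_le]
  have cS : ∀ X : Set (Set ι), (X ∩ L0) \ L1 = X ∩ S := fun X => by
    ext ω; simp only [hL0, hL1, hS, Set.mem_sdiff, Set.mem_inter_iff, Set.mem_setOf_eq, not_lt]; constructor
    · rintro ⟨⟨hX, h1⟩, h2⟩; exact ⟨hX, by omega⟩
    · rintro ⟨hX, h⟩; exact ⟨⟨hX, by omega⟩, by omega⟩
  have cSL : ∀ X : Set (Set ι), (X ∩ L0) ∩ L1 = X ∩ L1 := fun X => by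
    ext ω; simp only [hL0, hL1, Set.mem_inter_iff, Set.mem_setOf_eq]; constructor
    · rintro ⟨⟨hX, _⟩, h2⟩; exact ⟨hX, h2⟩
    · rintro ⟨hX, h⟩; exact ⟨⟨hX, by omega⟩, h⟩
  have cH1S : ∀ X : Set (Set ι), (H1 ∩ X) \ H0 = X ∩ S := fun X => by
    ext ω; simp only [hH1, hH0, hS, Set.mem_sdiff, Set.mem_inter_iff, Set.mem_setOf_eq, not_le]; constructor
    · rintro ⟨⟨h1, hX⟩, h2⟩; exact ⟨hX, by omega⟩
    · rintro ⟨hX, h⟩; exact ⟨⟨by omega, hX⟩, by omega⟩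
  have cH1H0 : ∀ X : Set (Set ι), (H1 ∩ X) ∩ H0 = H0 ∩ X := fun X => by
    ext ω; simp only [Set.mem_inter_iff]; constructor
    · rintro ⟨⟨_, hX⟩, h0⟩; exact ⟨h0, hX⟩
    · rintro ⟨h0, hX⟩; exact ⟨⟨hH01 h0, hX⟩, h0⟩
  -- splits: μ X = μ(H0 ∩ X) + μ(X ∩ L0), μ(X ∩ L0) = μ(X ∩ L1) + μ(X ∩ S), μ(H1 ∩ X) = μ(X ∩ S) + μ(H0 ∩ X)
  have split0 : ∀ X : Set (Set ι), μ.real X = μ.real (H0 ∩ X) + μ.real (X ∩ L0) := fun X => by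
    have h := measureReal_inter_add_sdiff (μ := μ) (s := X) (t := H0) MeasurableSet.of_discrete
    rw [cL0, Set.inter_comm X H0] at h; linarith
  have splitS : ∀ X : Set (Set ι), μ.real (X ∩ L0) = μ.real (X ∩ L1) + μ.real (X ∩ S) := fun X => by
    have h := measureReal_inter_add_sdiff (μ := μ) (s := X ∩ L0) (t := L1) MeasurableSet.of_discrete
    rw [cSL, cS] at h; linarith
  have splitH1 : ∀ X : Set (Set ι), μ.real (H1 ∩ X) = μ.real (X ∩ S) + μ.real (H0 ∩ X) := fun X => by
    have h := measureReal_inter_add_sdiff (μ := μ) (s := H1 ∩ X) (t := H0) MeasurableSet.of_discrete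
    rw [cH1H0, cH1S] at h; linarith
  -- the named quantities
  have eA1 : μ.real A1 = xH + (xL + xS) := by rw [split0 A1, splitS A1]
  have eH1A1 : μ.real (H1 ∩ A1) = xS + xH := splitH1 A1
  have eB : μ.real B = yH + (yL + yS) := by rw [split0 B, splitS B]
  have eA0 : μ.real A0 = a0H + a0Lo := split0 A0
  have eL0 : μ.real L0 = l1 + σ := by have h := splitS Set.univ; simp only [Set.univ_inter] at h; exact h
  have eH1 : μ.real H1 = 1 - l1 := by
    have h := splitH1 Set.univ; have h' := split0 Set.univ
    simp only [Set.inter_univ, Set.univ_inter, probReal_univ] at h h'; linarith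
  have eH0 : μ.real H0 = 1 - l1 - σ := by
    have h' := split0 Set.univ; simp only [Set.inter_univ, Set.univ_inter, probReal_univ] at h'; linarith
  -- the E-term: μ((H0 ∩ A0) \ B) ≤ μ((H0 ∩ A1) \ B)
  have eE1 : μ.real ((H0 ∩ A1) \ B) = xH - cH := by
    have h := measureReal_inter_add_sdiff (μ := μ) (s := H0 ∩ A1) (t := B) MeasurableSet.of_discrete; linarith
  have eE0 : μ.real ((H0 ∩ A0) \ B) = a0H - w0 := by
    have h := measureReal_inter_add_sdiff (μ := μ) (s := H0 ∩ A0) (t := B) MeasurableSet.of_discrete; linarith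
  have hE : a0H - w0 ≤ xH - cH := by
    rw [← eE1, ← eE0]
    exact measureReal_mono (Set.sdiff_subset_sdiff_left (Set.inter_subset_inter_right _ hA01))
  -- layer ≥ lower ball for `A1` and `B`
  have hUA : xL * σ ≤ xS * l1 := real_inter_ball_mul_layer_le' p F hA1u t
  have hUB : yL * σ ≤ yS * l1 := real_inter_ball_mul_layer_le' p F hB t
  -- the hypothesis `(2′)` for `(A1, B)` at `H0`, unfolded
  have hsec1' := hsec1
  rw [osN_ind_ind] at hsec1'
  change 0 ≤ xH * yH + (1 - μ.real H0) * cH + μ.real H0 * μ.real A1 * μ.real B - xH * μ.real B - yH * μ.real A1 at hsec1'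
  rw [eH0, eA1, eB] at hsec1'
  -- rewrite the goal in the piece variables
  rw [eA0, eH1, eA1, eH1A1, eB, eH0]
  simp only [mul_one]
  change 0 ≤ (a0H + a0Lo - a0H) * (1 - (1 - l1)) + (xH + (xL + xS) - (xS + xH)) * (yH + (yL + yS) - yH)
      + (1 - (1 - l1 - σ)) * (xS + xH) + (1 - (1 - l1)) * w0
      - ((1 - l1) - (1 - l1 - σ)) * (xH + (xL + xS)) - (1 - (1 - l1)) * ((xH + (xL + xS)) * (yH + (yL + yS)) + (a0H + a0Lo))
  -- nonnegativity of the pieces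
  have hl1 : 0 ≤ l1 := measureReal_nonneg
  have hσ0 : 0 ≤ σ := measureReal_nonneg
  have hySσ : yS ≤ σ := measureReal_mono Set.inter_subset_right
  have hxSσ : xS ≤ σ := measureReal_mono Set.inter_subset_right
  have hxS0 : 0 ≤ xS := measureReal_nonneg
  have hyS0 : 0 ≤ yS := measureReal_nonneg
  have hxL0 : 0 ≤ xL := measureReal_nonneg
  have hyL0 : 0 ≤ yL := measureReal_nonneg
  -- the polynomial identity:  σ ℓ⁰ M₂ = σ ℓ¹ n₀ + U_A U_B + ℓ⁰ μ(Bᶜ∩S) U_A + σ ℓ⁰ ℓ¹ E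
  have hid : σ * (l1 + σ) * ((a0H + a0Lo - a0H) * (1 - (1 - l1)) + (xH + (xL + xS) - (xS + xH)) * (yH + (yL + yS) - yH)
      + (1 - (1 - l1 - σ)) * (xS + xH) + (1 - (1 - l1)) * w0
      - ((1 - l1) - (1 - l1 - σ)) * (xH + (xL + xS)) - (1 - (1 - l1)) * ((xH + (xL + xS)) * (yH + (yL + yS)) + (a0H + a0Lo)))
      = σ * l1 * (xH * yH + (1 - (1 - l1 - σ)) * cH + (1 - l1 - σ) * (xH + (xL + xS)) * (yH + (yL + yS))
          - xH * (yH + (yL + yS)) - yH * (xH + (xL + xS)))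
        + (xS * l1 - xL * σ) * (yS * l1 - yL * σ) + (l1 + σ) * (σ - yS) * (xS * l1 - xL * σ)
        + σ * (l1 + σ) * l1 * ((xH - cH) - (a0H - w0)) := by
    ring
  by_cases hσpos : 0 < σ
  · have hpos : 0 < σ * (l1 + σ) := mul_pos hσpos (by linarith)
    refine (mul_nonneg_iff_of_pos_left hpos).1 ?_
    rw [hid]
    have t1 : 0 ≤ σ * l1 * (xH * yH + (1 - (1 - l1 - σ)) * cH + (1 - l1 - σ) * (xH + (xL + xS)) * (yH + (yL + yS))
        - xH * (yH + (yL + yS)) - yH * (xH + (xL + xS))) := mul_nonneg (mul_nonneg hσ0 hl1) hsec1'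
    have t2 : 0 ≤ (xS * l1 - xL * σ) * (yS * l1 - yL * σ) := mul_nonneg (by linarith) (by linarith)
    have t3 : 0 ≤ (l1 + σ) * (σ - yS) * (xS * l1 - xL * σ) := mul_nonneg (mul_nonneg (by linarith) (by linarith)) (by linarith)
    have t4 : 0 ≤ σ * (l1 + σ) * l1 * ((xH - cH) - (a0H - w0)) :=
      mul_nonneg (mul_nonneg (mul_nonneg hσ0 (by linarith)) hl1) (by linarith)
    linarith
  · -- degenerate layer: `σ = 0`, so `xS = yS = 0` and `M₂ = n₀ + ℓ¹·E`
    have hσz : σ = 0 := le_antisymm (not_lt.1 hσpos) hσ0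
    have hxSz : xS = 0 := le_antisymm (hσz ▸ hxSσ) hxS0
    have hySz : yS = 0 := le_antisymm (hσz ▸ hySσ) hyS0
    rw [hσz, hxSz, hySz]
    rw [hσz, hxSz, hySz] at hsec1'
    have hE' : 0 ≤ l1 * ((xH - cH) - (a0H - w0)) := mul_nonneg hl1 (by linarith)
    have hid0 : (a0H + a0Lo - a0H) * (1 - (1 - l1)) + (xH + (xL + 0) - (0 + xH)) * (yH + (yL + 0) - yH)
        + (1 - (1 - l1 - 0)) * (0 + xH) + (1 - (1 - l1)) * w0
        - ((1 - l1) - (1 - l1 - 0)) * (xH + (xL + 0)) - (1 - (1 - l1)) * ((xH + (xL + 0)) * (yH + (yL + 0)) + (a0H + a0Lo))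
        = (xH * yH + (1 - (1 - l1 - 0)) * cH + (1 - l1 - 0) * (xH + (xL + 0)) * (yH + (yL + 0))
          - xH * (yH + (yL + 0)) - yH * (xH + (xL + 0))) + l1 * ((xH - cH) - (a0H - w0)) := by ring
    rw [hid0]
    exact add_nonneg hsec1' hE'

/-! ## Universality is closed under OR-literals -/

/-- **Universality is preserved by an OR-literal.**  If the increasing event `B` (determined by `SB`, `e ∉ SB`) satisfies `(2′)` against every
increasing partner for every threshold slot, then so does `{e ∈ ω} ∪ B`. [this work] -/
theorem osN_orLiteral_universal (p : ι → unitInterval) {B : Set (Set ι)} (hB : IsUpperSet B) {SB : Finset ι}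
    (hBS : DeterminedBy B (↑SB : Set ι)) {e : ι} (heB : e ∉ SB)
    (huniv : ∀ (F : Finset ι) (t : ℕ) (A : Set (Set ι)), IsUpperSet A →
      0 ≤ osN p {ω : Set ι | t ≤ (F.filter (· ∈ ω)).card} (ind A) (ind B))
    (F : Finset ι) (t : ℕ) {A : Set (Set ι)} (hA : IsUpperSet A) :
    0 ≤ osN p {ω : Set ι | t ≤ (F.filter (· ∈ ω)).card} (ind A) (ind ({ω : Set ι | e ∈ ω} ∪ B)) := by
  by_cases he : e ∈ F
  · rcases Nat.eq_zero_or_pos t with ht | ht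
    · subst ht
      have huniv' : {ω : Set ι | 0 ≤ (F.filter (· ∈ ω)).card} = Set.univ := by ext ω; simp
      rw [huniv', osN_ind_ind]
      simp only [Set.univ_inter, probReal_univ]
      ring_nf; exact le_rfl
    · obtain ⟨t', rfl⟩ : ∃ t', t = t' + 1 := ⟨t - 1, by omega⟩
      have hF : F = insert e (F.erase e) := (Finset.insert_erase he).symm
      rw [hF]
      exact osN_threshold_orLiteral_step p (F.notMem_erase e) t' hA hB hBS heB
        (huniv (F.erase e) (t' + 1) _ (isUpperSet_section_insert hA e))
        (huniv (F.erase e) (t' + 1) _ (isUpperSet_section_sdiff hA e))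
  · have hB1 : {ω : Set ι | insert e ω ∈ ({ω : Set ι | e ∈ ω} ∪ B)} = Set.univ := section_insert_or B e
    have hB0 : {ω : Set ι | ω \ {e} ∈ ({ω : Set ι | e ∈ ω} ∪ B)} = B := section_sdiff_or hBS heB
    have hBe : IsUpperSet ({ω : Set ι | e ∈ ω} ∪ B) :=
      IsUpperSet.union (fun ω ω' (hle : ω ≤ ω') (h : e ∈ ω) => hle h) hB
    refine osN_threshold_nonneg_of_sections p F t hA hBe he ?_ ?_ ?_ ?_
    · rw [hB1, osN_ind_ind_univ_snd]
    · rw [hB0]; exact huniv F t _ (isUpperSet_section_sdiff hA e)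
    · rw [hB0]; exact huniv F t _ (isUpperSet_section_insert hA e)
    · rw [hB1, osN_ind_ind_univ_snd]

/-! ## Corollaries: `x_e ∨ Th_r(T)`, in particular `x_a ∨ x_b x_c`, against an arbitrary increasing event -/

/-- **`(2′)` for `B = {e ∈ ω} ∪ {N_T ≥ r}` against EVERY increasing `A`** (all `F, t`; `e ∉ T`; every product measure). [this work] -/
theorem osN_orBlockThreshold_nonneg (p : ι → unitInterval) (F : Finset ι) (t : ℕ) {e : ι} {T : Finset ι} (heT : e ∉ T) (r : ℕ)
    {A : Set (Set ι)} (hA : IsUpperSet A) :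
    0 ≤ osN p {ω : Set ι | t ≤ (F.filter (· ∈ ω)).card} (ind A)
      (ind ({ω : Set ι | e ∈ ω} ∪ {ω : Set ι | r ≤ (T.filter (· ∈ ω)).card})) :=
  osN_orLiteral_universal p (isUpperSet_threshold T r) (determinedBy_threshold T r) heT
    (fun F' t' _ hA' => osN_threshold_blockThreshold_nonneg p F' t' _ T r rfl hA') F t hA

/-- **KAHN C5 / SAHI `C₃` for {threshold slot, ARBITRARY increasing event, literal ∨ block threshold}.**  For every product measure, all
blocks `F, T`, all `t, r`, every `e ∉ T` and EVERY increasing `A`:  `0 ≤ E₃(1_{N_F ≥ t}, 1_A, 1_{x_e ∨ N_T ≥ r})`.  With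
`sahiE3_andBlockThreshold_nonneg` and gen 20's `sahiE3_threshold_blockThreshold_nonneg`: Kahn's conjecture for a threshold first slot holds
whenever one of the two other events is a monotone function of at most THREE coordinates. [this work] -/
theorem sahiE3_orBlockThreshold_nonneg (p : ι → unitInterval) (F : Finset ι) (t : ℕ) {e : ι} {T : Finset ι} (heT : e ∉ T) (r : ℕ)
    {A : Set (Set ι)} (hA : IsUpperSet A) :
    0 ≤ sahiE3 (prodBernoulli p) {ω : Set ι | t ≤ (F.filter (· ∈ ω)).card} A
      ({ω : Set ι | e ∈ ω} ∪ {ω : Set ι | r ≤ (T.filter (· ∈ ω)).card}) := by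
  have hB : IsUpperSet ({ω : Set ι | e ∈ ω} ∪ {ω : Set ι | r ≤ (T.filter (· ∈ ω)).card}) :=
    IsUpperSet.union (fun ω ω' (hle : ω ≤ ω') (h : e ∈ ω) => hle h) (isUpperSet_threshold T r)
  rw [← osT_ind_ind, osT_eq_osMp_add_osN]
  exact add_nonneg (osMp_threshold_nonneg_all p F t hA hB) (osN_orBlockThreshold_nonneg p F t heT r hA)

/-- **`x_a ∨ x_b x_c` against an arbitrary increasing event**: for distinct-from-`a` coordinates `b, c`, every slot block `F`, level `t`,
EVERY increasing `A` and every product measure, `0 ≤ E₃(1_{N_F ≥ t}, 1_A, 1_{x_a ∨ x_b x_c})` — the last monotone function of three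
variables (the others are thresholds of blocks, `x_a(x_b ∨ x_c)` is `sahiE3_andBlockThreshold_nonneg`). [this work] -/
theorem sahiE3_orAndPair_nonneg (p : ι → unitInterval) (F : Finset ι) (t : ℕ) {a b c : ι} (hab : a ≠ b) (hac : a ≠ c)
    {A : Set (Set ι)} (hA : IsUpperSet A) :
    0 ≤ sahiE3 (prodBernoulli p) {ω : Set ι | t ≤ (F.filter (· ∈ ω)).card} A
      ({ω : Set ι | a ∈ ω} ∪ {ω : Set ι | 2 ≤ (({b, c} : Finset ι).filter (· ∈ ω)).card}) :=
  sahiE3_orBlockThreshold_nonneg p F t (by simp [hab, hac]) 2 hA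

end SahiOneStep

end Summit.CriticalPhenomena.PercolationContinuityZ3.Theorems
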